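import Literature.Probability.RandomPlanarGeometry.HexSAWBrickWallPolygonGlue
import HarnessLib

/-!
# Honeycomb polygons from bridges, IV: the four connector designs

Topic `Literature/Probability/RandomPlanarGeometry` (lane «pcv-sawmu», door «HEX-SAP» `μ_polygon(ℍ) = μ_ℍ`;
continues `HexSAWBrickWallPolygonGlue.lean`, which glues two half-plane pieces of the same class `(y, s)` into a
honeycomb polygon given connector data `IsDesign y s J C L`).  Source frame: N. Madras, G. Slade, *The
Self-Avoiding Walk* (1993), §3.2, proof of Theorem 3.2.4 ("let `e` be a nearest neighbour of the origin such that
`e · v < 0` … followed by one step in the `e` direction"); on the honeycomb lattice the single step `e` is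
replaced by explicit staircases (this lane's repair of the parity obstruction, see the header of
`HexSAWBrickWallPieces.lean`).

With `u = (0,1)`, `e = (ε, 0)`, `ε = −sgn y₁` (so `φ_y(u) = y₀ > 0`, `φ_y(e) = |y₁| > 0`), writing `(a, b)` for
`a u + b e`:
* type L (`s = 1`, pieces in `φ_y ≤ 0`): junction `JL = (0,0),(1,0),(1,1),(2,1),(2,2),(2,3)`; closing
  `CL = (2,3),(1,3),(1,2),(0,2),(0,1)` (`L = 4`) or, with a one-brick bump,
  `CL' = (2,3),(2,2),(2,1),(1,1),(1,2),(0,2),(0,1)` (`L = 6`);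
* type U (`s = −1`, pieces in `φ_y ≥ 0`): `JU = (0,0),(0,−1),(−1,−1),(−1,−2),(−2,−2),(−2,−3)`;
  `CU = (−2,−3),(−2,−2),(−1,−2),(−1,−1),(0,−1)` (`L = 4`) or
  `CU' = (−2,−3),(−2,−2),(−2,−1),(−2,0),(−1,0),(−1,−1),(0,−1)` (`L = 6`).
All four end at the horizontal neighbour `±e` of `0`; the polygon lengths are `2n + 10` and `2n + 12`.

## Contents (namespace `Literature.Probability.RandomPlanarGeometry.SAW.HexBW`, all PROVED)

* `off ε a b = a u + b e`, `adj_off`, `off_inj`, `phi_off`;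
* the six tables and **`isDesign_L`, `isDesign_L'`, `isDesign_U`, `isDesign_U'`** (`IsDesign y (±1) … (4|6)`
  for every `y` with `0 < y₀` and `ε y₁ < 0`, `ε = ±1`); `JL_five`, `JU_five`, `CL_of_ge`, `CL'_of_ge`, `CU_of_ge`,
  `CU'_of_ge` (the endpoints `d` and `±e`).
-/

noncomputable section

open Finset Function Literature.Probability.LatticeModels Literature.Probability.Percolation SimpleGraph

namespace Literature.Probability.RandomPlanarGeometry.SAW

namespace HexBW

/-! ### Offsets `a u + b e` -/

/-- The site `a u + b e = (b ε, a)`, `u = (0,1)`, `e = (ε, 0)`. [cite: MadrasSlade1993, §3.2 (proof of Theorem 3.2.4: the step `e`)] -/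
def off (ε a b : ℤ) : Site 2 := ![b * ε, a]

/-- Height of an offset. [cite: MadrasSlade1993, §3.2 (proof of Theorem 3.2.4)] -/
@[simp] theorem off_apply_zero (ε a b : ℤ) : off ε a b 0 = b * ε := rfl

/-- Second coordinate of an offset. [cite: MadrasSlade1993, §3.2 (proof of Theorem 3.2.4)] -/
@[simp] theorem off_apply_one (ε a b : ℤ) : off ε a b 1 = a := rfl

/-- `off ε 0 0 = 0`. [cite: MadrasSlade1993, §3.2 (proof of Theorem 3.2.4)] -/
theorem off_zero_zero (ε : ℤ) : off ε 0 0 = 0 := by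
  funext j; fin_cases j <;> simp

/-- Offsets are determined by their coefficients (`ε = ±1`). [cite: MadrasSlade1993, §3.2 (proof of Theorem 3.2.4)] -/
theorem off_inj {ε : ℤ} (hε : ε = 1 ∨ ε = -1) {a b a' b' : ℤ} (h : off ε a b = off ε a' b') :
    a = a' ∧ b = b' := by
  have h0 := congrFun h 0
  have h1 := congrFun h 1
  simp only [off_apply_zero, off_apply_one] at h0 h1
  rcases hε with rfl | rfl
  · constructor <;> linarith
  · constructor <;> linarith

/-- `φ_y(a u + b e) = a y₀ − b ε y₁`. [cite: MadrasSlade1993, §3.2 (proof of Theorem 3.2.4)] -/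
theorem phi_off (y : Site 2) (ε a b : ℤ) : Zd.phi y (off ε a b) = a * y 0 - b * (ε * y 1) := by
  simp only [Zd.phi, off_apply_zero, off_apply_one]; ring

/-- **Brick-wall bonds between offsets**: horizontal steps always, vertical steps `a → a + 1` from sites
`(a, b)` with `a + b` even (`ε` odd). [cite: EntingJensen2009, §7.4.2, Fig. 7.10 (brickwork form of the honeycomb lattice)] -/
theorem adj_off {ε : ℤ} (hε : ε = 1 ∨ ε = -1) {a b a' b' : ℤ}
    (h : (a' = a ∧ (b' = b + 1 ∨ b = b' + 1)) ∨ (b' = b ∧ a' = a + 1 ∧ (a + b) % 2 = 0) ∨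
      (b' = b ∧ a = a' + 1 ∧ (a' + b') % 2 = 0)) :
    brickWallGraph.Adj (off ε a b) (off ε a' b') := by
  rw [brickWallGraph_adj_coord]
  simp only [off_apply_zero, off_apply_one]
  rcases hε with rfl | rfl <;> omega

/-- The horizontal neighbours `±e = (0, ±1)` of `0`. [cite: EntingJensen2009, §7.4.2, Fig. 7.10 (brickwork form of the honeycomb lattice)] -/
theorem adj_off_zero_one {ε : ℤ} (hε : ε = 1 ∨ ε = -1) {b : ℤ} (hb : b = 1 ∨ b = -1) :
    brickWallGraph.Adj (off ε 0 b) 0 := by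
  rw [brickWallGraph_adj_coord]
  simp only [off_apply_zero, off_apply_one, Pi.zero_apply]
  rcases hε with rfl | rfl <;> rcases hb with rfl | rfl <;> simp

/-! ### The six tables -/

/-- Junction of type L: `u, e, u, e, e`. [cite: MadrasSlade1993, §3.2 (proof of Theorem 3.2.4: the step `e`)] -/
def JL (ε : ℤ) : ℕ → Site 2
  | 0 => off ε 0 0
  | 1 => off ε 1 0
  | 2 => off ε 1 1
  | 3 => off ε 2 1
  | 4 => off ε 2 2
  | _ => off ε 2 3

/-- Closing connector of type L, no bump (`L = 4`). [cite: MadrasSlade1993, §3.2 (proof of Theorem 3.2.4: the step `e`)] -/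
def CL (ε : ℤ) : ℕ → Site 2
  | 0 => off ε 2 3
  | 1 => off ε 1 3
  | 2 => off ε 1 2
  | 3 => off ε 0 2
  | _ => off ε 0 1

/-- Closing connector of type L with a one-brick bump (`L = 6`). [cite: MadrasSlade1993, §3.2 (proof of Theorem 3.2.4: the step `e`)] -/
def CL' (ε : ℤ) : ℕ → Site 2
  | 0 => off ε 2 3
  | 1 => off ε 2 2
  | 2 => off ε 2 1
  | 3 => off ε 1 1
  | 4 => off ε 1 2
  | 5 => off ε 0 2
  | _ => off ε 0 1

/-- Junction of type U: `−e, −u, −e, −u, −e`. [cite: MadrasSlade1993, §3.2 (proof of Theorem 3.2.4: the step `e`)] -/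
def JU (ε : ℤ) : ℕ → Site 2
  | 0 => off ε 0 0
  | 1 => off ε 0 (-1)
  | 2 => off ε (-1) (-1)
  | 3 => off ε (-1) (-2)
  | 4 => off ε (-2) (-2)
  | _ => off ε (-2) (-3)

/-- Closing connector of type U, no bump (`L = 4`). [cite: MadrasSlade1993, §3.2 (proof of Theorem 3.2.4: the step `e`)] -/
def CU (ε : ℤ) : ℕ → Site 2
  | 0 => off ε (-2) (-3)
  | 1 => off ε (-2) (-2)
  | 2 => off ε (-1) (-2)
  | 3 => off ε (-1) (-1)
  | _ => off ε 0 (-1)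

/-- Closing connector of type U with a one-brick bump (`L = 6`). [cite: MadrasSlade1993, §3.2 (proof of Theorem 3.2.4: the step `e`)] -/
def CU' (ε : ℤ) : ℕ → Site 2
  | 0 => off ε (-2) (-3)
  | 1 => off ε (-2) (-2)
  | 2 => off ε (-2) (-1)
  | 3 => off ε (-2) 0
  | 4 => off ε (-1) 0
  | 5 => off ε (-1) (-1)
  | _ => off ε 0 (-1)

section Tables

variable {ε : ℤ} {y : Site 2}

/-- Frozen tails of the tables. [cite: MadrasSlade1993, §3.2 (proof of Theorem 3.2.4)] -/
theorem JL_of_ge {k : ℕ} (hk : 5 ≤ k) : JL ε k = off ε 2 3 := by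
  obtain ⟨j, rfl⟩ : ∃ j, k = j + 5 := ⟨k - 5, by omega⟩; simp [JL]

/-- Frozen tails of the tables. [cite: MadrasSlade1993, §3.2 (proof of Theorem 3.2.4)] -/
theorem JU_of_ge {k : ℕ} (hk : 5 ≤ k) : JU ε k = off ε (-2) (-3) := by
  obtain ⟨j, rfl⟩ : ∃ j, k = j + 5 := ⟨k - 5, by omega⟩; simp [JU]

/-- Frozen tails of the tables. [cite: MadrasSlade1993, §3.2 (proof of Theorem 3.2.4)] -/
theorem CL_of_ge {k : ℕ} (hk : 4 ≤ k) : CL ε k = off ε 0 1 := by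
  obtain ⟨j, rfl⟩ : ∃ j, k = j + 4 := ⟨k - 4, by omega⟩; simp [CL]

/-- Frozen tails of the tables. [cite: MadrasSlade1993, §3.2 (proof of Theorem 3.2.4)] -/
theorem CU_of_ge {k : ℕ} (hk : 4 ≤ k) : CU ε k = off ε 0 (-1) := by
  obtain ⟨j, rfl⟩ : ∃ j, k = j + 4 := ⟨k - 4, by omega⟩; simp [CU]

/-- Frozen tails of the tables. [cite: MadrasSlade1993, §3.2 (proof of Theorem 3.2.4)] -/
theorem CL'_of_ge {k : ℕ} (hk : 6 ≤ k) : CL' ε k = off ε 0 1 := by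
  obtain ⟨j, rfl⟩ : ∃ j, k = j + 6 := ⟨k - 6, by omega⟩; simp [CL']

/-- Frozen tails of the tables. [cite: MadrasSlade1993, §3.2 (proof of Theorem 3.2.4)] -/
theorem CU'_of_ge {k : ℕ} (hk : 6 ≤ k) : CU' ε k = off ε 0 (-1) := by
  obtain ⟨j, rfl⟩ : ∃ j, k = j + 6 := ⟨k - 6, by omega⟩; simp [CU']

/-- `JL 5 = d = (2,3)`. [cite: MadrasSlade1993, §3.2 (proof of Theorem 3.2.4)] -/
theorem JL_five : JL ε 5 = off ε 2 3 := JL_of_ge le_rfl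

/-- `JU 5 = d = (−2,−3)`. [cite: MadrasSlade1993, §3.2 (proof of Theorem 3.2.4)] -/
theorem JU_five : JU ε 5 = off ε (-2) (-3) := JU_of_ge le_rfl

/-- The steps of `JL` are brick-wall bonds. [cite: EntingJensen2009, §7.4.2, Fig. 7.10 (brickwork form of the honeycomb lattice)] -/
theorem JL_adj (hε : ε = 1 ∨ ε = -1) : ∀ k < 5, brickWallGraph.Adj (JL ε k) (JL ε (k + 1)) := by
  intro k hk
  interval_cases k <;> simp only [JL] <;> exact adj_off hε (by omega)

/-- The steps of `JU` are brick-wall bonds. [cite: EntingJensen2009, §7.4.2, Fig. 7.10 (brickwork form of the honeycomb lattice)] -/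
theorem JU_adj (hε : ε = 1 ∨ ε = -1) : ∀ k < 5, brickWallGraph.Adj (JU ε k) (JU ε (k + 1)) := by
  intro k hk
  interval_cases k <;> simp only [JU] <;> exact adj_off hε (by omega)

/-- The steps of `CL` are brick-wall bonds. [cite: EntingJensen2009, §7.4.2, Fig. 7.10 (brickwork form of the honeycomb lattice)] -/
theorem CL_adj (hε : ε = 1 ∨ ε = -1) : ∀ k < 4, brickWallGraph.Adj (CL ε k) (CL ε (k + 1)) := by
  intro k hk
  interval_cases k <;> simp only [CL] <;> exact adj_off hε (by omega)

/-- The steps of `CU` are brick-wall bonds. [cite: EntingJensen2009, §7.4.2, Fig. 7.10 (brickwork form of the honeycomb lattice)] -/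
theorem CU_adj (hε : ε = 1 ∨ ε = -1) : ∀ k < 4, brickWallGraph.Adj (CU ε k) (CU ε (k + 1)) := by
  intro k hk
  interval_cases k <;> simp only [CU] <;> exact adj_off hε (by omega)

/-- The steps of `CL'` are brick-wall bonds. [cite: EntingJensen2009, §7.4.2, Fig. 7.10 (brickwork form of the honeycomb lattice)] -/
theorem CL'_adj (hε : ε = 1 ∨ ε = -1) : ∀ k < 6, brickWallGraph.Adj (CL' ε k) (CL' ε (k + 1)) := by
  intro k hk
  interval_cases k <;> simp only [CL'] <;> exact adj_off hε (by omega)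

/-- The steps of `CU'` are brick-wall bonds. [cite: EntingJensen2009, §7.4.2, Fig. 7.10 (brickwork form of the honeycomb lattice)] -/
theorem CU'_adj (hε : ε = 1 ∨ ε = -1) : ∀ k < 6, brickWallGraph.Adj (CU' ε k) (CU' ε (k + 1)) := by
  intro k hk
  interval_cases k <;> simp only [CU'] <;> exact adj_off hε (by omega)

/-- `JL` is injective on `[0,5]`. [cite: MadrasSlade1993, §3.2 (proof of Theorem 3.2.4)] -/
theorem JL_inj (hε : ε = 1 ∨ ε = -1) : Set.InjOn (JL ε) {k | k ≤ 5} := by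
  intro i hi j hj h
  simp only [Set.mem_setOf_eq] at hi hj
  interval_cases i <;> interval_cases j <;> simp only [JL] at h <;>
    first | rfl | (obtain ⟨h1, h2⟩ := off_inj hε h; omega)

/-- `JU` is injective on `[0,5]`. [cite: MadrasSlade1993, §3.2 (proof of Theorem 3.2.4)] -/
theorem JU_inj (hε : ε = 1 ∨ ε = -1) : Set.InjOn (JU ε) {k | k ≤ 5} := by
  intro i hi j hj h
  simp only [Set.mem_setOf_eq] at hi hj
  interval_cases i <;> interval_cases j <;> simp only [JU] at h <;>
    first | rfl | (obtain ⟨h1, h2⟩ := off_inj hε h; omega)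

/-- `CL` is injective on `[0,4]`. [cite: MadrasSlade1993, §3.2 (proof of Theorem 3.2.4)] -/
theorem CL_inj (hε : ε = 1 ∨ ε = -1) : Set.InjOn (CL ε) {k | k ≤ 4} := by
  intro i hi j hj h
  simp only [Set.mem_setOf_eq] at hi hj
  interval_cases i <;> interval_cases j <;> simp only [CL] at h <;>
    first | rfl | (obtain ⟨h1, h2⟩ := off_inj hε h; omega)

/-- `CU` is injective on `[0,4]`. [cite: MadrasSlade1993, §3.2 (proof of Theorem 3.2.4)] -/
theorem CU_inj (hε : ε = 1 ∨ ε = -1) : Set.InjOn (CU ε) {k | k ≤ 4} := by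
  intro i hi j hj h
  simp only [Set.mem_setOf_eq] at hi hj
  interval_cases i <;> interval_cases j <;> simp only [CU] at h <;>
    first | rfl | (obtain ⟨h1, h2⟩ := off_inj hε h; omega)

/-- `CL'` is injective on `[0,6]`. [cite: MadrasSlade1993, §3.2 (proof of Theorem 3.2.4)] -/
theorem CL'_inj (hε : ε = 1 ∨ ε = -1) : Set.InjOn (CL' ε) {k | k ≤ 6} := by
  intro i hi j hj h
  simp only [Set.mem_setOf_eq] at hi hj
  interval_cases i <;> interval_cases j <;> simp only [CL'] at h <;>
    first | rfl | (obtain ⟨h1, h2⟩ := off_inj hε h; omega)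

/-- `CU'` is injective on `[0,6]`. [cite: MadrasSlade1993, §3.2 (proof of Theorem 3.2.4)] -/
theorem CU'_inj (hε : ε = 1 ∨ ε = -1) : Set.InjOn (CU' ε) {k | k ≤ 6} := by
  intro i hi j hj h
  simp only [Set.mem_setOf_eq] at hi hj
  interval_cases i <;> interval_cases j <;> simp only [CU'] at h <;>
    first | rfl | (obtain ⟨h1, h2⟩ := off_inj hε h; omega)

end Tables

/-! ### The four designs -/

section Designs

variable {ε : ℤ} {y : Site 2}

/-- **Design L (no bump)**: `IsDesign y 1 JL CL 4` whenever `y₀ > 0` and `ε y₁ < 0`.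
[cite: MadrasSlade1993, §3.2 (proof of Theorem 3.2.4)] -/
theorem isDesign_L (hε : ε = 1 ∨ ε = -1) (hy0 : 0 < y 0) (hY : ε * y 1 < 0) : IsDesign y 1 (JL ε) (CL ε) 4 where
  J_zero := off_zero_zero ε
  J_adj := JL_adj hε
  J_of_ge := fun k hk => by rw [JL_of_ge hk, JL_five]
  J_inj := JL_inj hε
  J_pos := fun k hk1 hk5 => by
    interval_cases k <;> simp only [JL, phi_off] <;> nlinarith
  J_lt := fun k hk1 hk4 => by
    interval_cases k <;> simp only [JL, phi_off] <;> nlinarith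
  J_height := fun k hk1 hk4 => by
    interval_cases k <;> simp only [JL, off_apply_zero] <;> rcases hε with rfl | rfl <;> simp
  d_odd := by rw [JL_five]; simp only [off_apply_zero, off_apply_one]; rcases hε with rfl | rfl <;> decide
  C_zero := by simp only [CL, JL_five]
  C_adj := CL_adj hε
  C_of_ge := fun k hk => by rw [CL_of_ge hk, CL_of_ge le_rfl]
  C_inj := CL_inj hε
  C_pos := fun k hk1 hk4 => by
    rcases lt_or_ge k 4 with h | h
    · interval_cases k <;> simp only [CL, phi_off] <;> nlinarith
    · rw [CL_of_ge h, phi_off]; nlinarith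
  C_lt := fun k hk1 hk4 => by
    rcases lt_or_ge k 4 with h | h
    · interval_cases k <;> simp only [CL, JL_five, phi_off] <;> nlinarith
    · rw [CL_of_ge h, JL_five, phi_off, phi_off]; nlinarith
  C_height := fun k hk1 hk4 => by
    rcases lt_or_ge k 4 with h | h
    · interval_cases k <;> simp only [CL, off_apply_zero] <;> rcases hε with rfl | rfl <;> simp
    · rw [CL_of_ge h, off_apply_zero]; rcases hε with rfl | rfl <;> simp
  C_end := by rw [CL_of_ge le_rfl]; exact adj_off_zero_one hε (Or.inl rfl)

/-- **Design L with bump**: `IsDesign y 1 JL CL' 6`. [cite: MadrasSlade1993, §3.2 (proof of Theorem 3.2.4)] -/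
theorem isDesign_L' (hε : ε = 1 ∨ ε = -1) (hy0 : 0 < y 0) (hY : ε * y 1 < 0) : IsDesign y 1 (JL ε) (CL' ε) 6 where
  J_zero := off_zero_zero ε
  J_adj := JL_adj hε
  J_of_ge := fun k hk => by rw [JL_of_ge hk, JL_five]
  J_inj := JL_inj hε
  J_pos := fun k hk1 hk5 => by
    interval_cases k <;> simp only [JL, phi_off] <;> nlinarith
  J_lt := fun k hk1 hk4 => by
    interval_cases k <;> simp only [JL, phi_off] <;> nlinarith
  J_height := fun k hk1 hk4 => by
    interval_cases k <;> simp only [JL, off_apply_zero] <;> rcases hε with rfl | rfl <;> simp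
  d_odd := by rw [JL_five]; simp only [off_apply_zero, off_apply_one]; rcases hε with rfl | rfl <;> decide
  C_zero := by simp only [CL', JL_five]
  C_adj := CL'_adj hε
  C_of_ge := fun k hk => by rw [CL'_of_ge hk, CL'_of_ge le_rfl]
  C_inj := CL'_inj hε
  C_pos := fun k hk1 hk6 => by
    rcases lt_or_ge k 6 with h | h
    · interval_cases k <;> simp only [CL', phi_off] <;> nlinarith
    · rw [CL'_of_ge h, phi_off]; nlinarith
  C_lt := fun k hk1 hk6 => by
    rcases lt_or_ge k 6 with h | h
    · interval_cases k <;> simp only [CL', JL_five, phi_off] <;> nlinarith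
    · rw [CL'_of_ge h, JL_five, phi_off, phi_off]; nlinarith
  C_height := fun k hk1 hk6 => by
    rcases lt_or_ge k 6 with h | h
    · interval_cases k <;> simp only [CL', off_apply_zero] <;> rcases hε with rfl | rfl <;> simp
    · rw [CL'_of_ge h, off_apply_zero]; rcases hε with rfl | rfl <;> simp
  C_end := by rw [CL'_of_ge le_rfl]; exact adj_off_zero_one hε (Or.inl rfl)

/-- **Design U (no bump)**: `IsDesign y (−1) JU CU 4` whenever `y₀ > 0` and `ε y₁ < 0`.
[cite: MadrasSlade1993, §3.2 (proof of Theorem 3.2.4)] -/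
theorem isDesign_U (hε : ε = 1 ∨ ε = -1) (hy0 : 0 < y 0) (hY : ε * y 1 < 0) :
    IsDesign y (-1) (JU ε) (CU ε) 4 where
  J_zero := off_zero_zero ε
  J_adj := JU_adj hε
  J_of_ge := fun k hk => by rw [JU_of_ge hk, JU_five]
  J_inj := JU_inj hε
  J_pos := fun k hk1 hk5 => by
    interval_cases k <;> simp only [JU, phi_off] <;> nlinarith
  J_lt := fun k hk1 hk4 => by
    interval_cases k <;> simp only [JU, phi_off] <;> nlinarith
  J_height := fun k hk1 hk4 => by
    interval_cases k <;> simp only [JU, off_apply_zero] <;> rcases hε with rfl | rfl <;> simp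
  d_odd := by rw [JU_five]; simp only [off_apply_zero, off_apply_one]; rcases hε with rfl | rfl <;> decide
  C_zero := by simp only [CU, JU_five]
  C_adj := CU_adj hε
  C_of_ge := fun k hk => by rw [CU_of_ge hk, CU_of_ge le_rfl]
  C_inj := CU_inj hε
  C_pos := fun k hk1 hk4 => by
    rcases lt_or_ge k 4 with h | h
    · interval_cases k <;> simp only [CU, phi_off] <;> nlinarith
    · rw [CU_of_ge h, phi_off]; nlinarith
  C_lt := fun k hk1 hk4 => by
    rcases lt_or_ge k 4 with h | h
    · interval_cases k <;> simp only [CU, JU_five, phi_off] <;> nlinarith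
    · rw [CU_of_ge h, JU_five, phi_off, phi_off]; nlinarith
  C_height := fun k hk1 hk4 => by
    rcases lt_or_ge k 4 with h | h
    · interval_cases k <;> simp only [CU, off_apply_zero] <;> rcases hε with rfl | rfl <;> simp
    · rw [CU_of_ge h, off_apply_zero]; rcases hε with rfl | rfl <;> simp
  C_end := by rw [CU_of_ge le_rfl]; exact adj_off_zero_one hε (Or.inr rfl)

/-- **Design U with bump**: `IsDesign y (−1) JU CU' 6`. [cite: MadrasSlade1993, §3.2 (proof of Theorem 3.2.4)] -/
theorem isDesign_U' (hε : ε = 1 ∨ ε = -1) (hy0 : 0 < y 0) (hY : ε * y 1 < 0) :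
    IsDesign y (-1) (JU ε) (CU' ε) 6 where
  J_zero := off_zero_zero ε
  J_adj := JU_adj hε
  J_of_ge := fun k hk => by rw [JU_of_ge hk, JU_five]
  J_inj := JU_inj hε
  J_pos := fun k hk1 hk5 => by
    interval_cases k <;> simp only [JU, phi_off] <;> nlinarith
  J_lt := fun k hk1 hk4 => by
    interval_cases k <;> simp only [JU, phi_off] <;> nlinarith
  J_height := fun k hk1 hk4 => by
    interval_cases k <;> simp only [JU, off_apply_zero] <;> rcases hε with rfl | rfl <;> simp
  d_odd := by rw [JU_five]; simp only [off_apply_zero, off_apply_one]; rcases hε with rfl | rfl <;> decide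
  C_zero := by simp only [CU', JU_five]
  C_adj := CU'_adj hε
  C_of_ge := fun k hk => by rw [CU'_of_ge hk, CU'_of_ge le_rfl]
  C_inj := CU'_inj hε
  C_pos := fun k hk1 hk6 => by
    rcases lt_or_ge k 6 with h | h
    · interval_cases k <;> simp only [CU', phi_off] <;> nlinarith
    · rw [CU'_of_ge h, phi_off]; nlinarith
  C_lt := fun k hk1 hk6 => by
    rcases lt_or_ge k 6 with h | h
    · interval_cases k <;> simp only [CU', JU_five, phi_off] <;> nlinarith
    · rw [CU'_of_ge h, JU_five, phi_off, phi_off]; nlinarith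
  C_height := fun k hk1 hk6 => by
    rcases lt_or_ge k 6 with h | h
    · interval_cases k <;> simp only [CU', off_apply_zero] <;> rcases hε with rfl | rfl <;> simp
    · rw [CU'_of_ge h, off_apply_zero]; rcases hε with rfl | rfl <;> simp
  C_end := by rw [CU'_of_ge le_rfl]; exact adj_off_zero_one hε (Or.inr rfl)

end Designs

end HexBW

end Literature.Probability.RandomPlanarGeometry.SAW
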